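import Literature.Computation.KummerOrbifold.Certificate5
import HarnessLib

/-!
# Kummer orbifold model, `m = 5`: the operators as linear maps, the generated module `C₀`, and the
# kernel consequences of the certificate (`[L_{ω₀}, Λ₀] = h`, `[h, Λ₀] = -2Λ₀` on the whole raw space)

Area `Literature/Computation/KummerOrbifold` (cell `hodge-kum4`, ladder HodgeAV rung H3, seat p1).
Over any field `K` of characteristic `0`, on the raw space `ℕ →₀ K` (raw indices of the
`A[5]`-invariant Fu–Tian–Vial model, `Columns`/`Certificate5`):
* `genOp K j = colOp K (colGen5 j)` (multiplication by generator `j`, `j < 16`; `j = 15` is `ω₀`),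
  `lefOp K = genOp K 15 = L_{ω₀}`, `lamOp K = Λ₀`, `degOp K = h` (diagonal, `deg - 8`, zero outside
  the layout), `seedVec K s` / `seedDeg s` (the 17 seeds: unit, degree-2 and degree-3 block bases, `ω₀`);
* `modelSpace K = C₀`: the smallest submodule containing the seeds and stable under `Λ₀` and all
  `genOp K j` — the receptacle of the named fact `MODEL_X` of the H3 chain (which identifies it,
  `ℂ`-linearly, gradedly and multiplicatively on generators, with `H*(X(ℂ); ℂ)^{frame}` for `X` of
  `Kum⁴`-type); its minimality (`modelSpace_le`) is what the Lie-generation lemma consumes;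
* KERNEL CONSEQUENCES of `certificate5` (no further computation): `lef_lam_single`, `deg_lam_single`
  on basis vectors and, by `Finsupp` extensionality, the linear-map identities
  **`lef_comp_lam_sub`**: `L_{ω₀} ∘ Λ₀ - Λ₀ ∘ L_{ω₀} = h` and **`deg_comp_lam_sub`**:
  `h ∘ Λ₀ - Λ₀ ∘ h = -2 • Λ₀` on ALL of `ℕ →₀ K`.

Sources: Fu–Tian–Vial 2019 Thm. 1.5; Fantechi–Göttsche 2003 §3; Looijenga–Lunts 1997 §1 (sl₂-triples
`(e, h, f)` on graded modules).
-/

set_option autoImplicit false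

namespace Literature.Computation.KummerOrbifold

open Literature.Computation.Sparse SpVec

variable (K : Type*) [Field K] [CharZero K]

omit [CharZero K] in
/-- The seeds lie in `C₀`. [cite: FuTianVial2019, Thm. 1.5 (and Thm. 1.4; the orbifold product of §2 with discrete torsion)] -/
theorem seedVec_mem (s : ℕ) : seedVec K s ∈ modelSpace K := by
  simp only [modelSpace, Submodule.mem_sInf, Set.mem_setOf_eq]
  exact fun S hS ↦ hS.1 s

omit [CharZero K] in
/-- `C₀` is `Λ₀`-stable. [cite: FuTianVial2019, Thm. 1.5 (and Thm. 1.4; the orbifold product of §2 with discrete torsion)] -/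
theorem lamOp_mem {v : ℕ →₀ K} (hv : v ∈ modelSpace K) : lamOp K v ∈ modelSpace K := by
  simp only [modelSpace, Submodule.mem_sInf, Set.mem_setOf_eq] at hv ⊢
  exact fun S hS ↦ hS.2.1 v (hv S hS)

omit [CharZero K] in
/-- `C₀` is stable under the generator multiplications. [cite: FuTianVial2019, Thm. 1.5 (and Thm. 1.4; the orbifold product of §2 with discrete torsion)] -/
theorem genOp_mem {j : ℕ} (hj : j < 16) {v : ℕ →₀ K} (hv : v ∈ modelSpace K) :
    genOp K j v ∈ modelSpace K := by
  simp only [modelSpace, Submodule.mem_sInf, Set.mem_setOf_eq] at hv ⊢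
  exact fun S hS ↦ hS.2.2 j hj v (hv S hS)

omit [CharZero K] in
/-- `C₀` is `L_{ω₀}`-stable (`L_{ω₀} = genOp 15`). [cite: FuTianVial2019, Thm. 1.5 (and Thm. 1.4; the orbifold product of §2 with discrete torsion)] -/
theorem lefOp_mem {v : ℕ →₀ K} (hv : v ∈ modelSpace K) : lefOp K v ∈ modelSpace K :=
  genOp_mem K (by norm_num) hv

omit [CharZero K] in
/-- Minimality of `C₀`. [cite: FuTianVial2019, Thm. 1.5 (and Thm. 1.4; the orbifold product of §2 with discrete torsion)] -/
theorem modelSpace_le {S : Submodule K (ℕ →₀ K)} (hs : ∀ s, seedVec K s ∈ S)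
    (hl : ∀ v ∈ S, lamOp K v ∈ S) (hg : ∀ j < 16, ∀ v ∈ S, genOp K j v ∈ S) : modelSpace K ≤ S :=
  sInf_le ⟨hs, hl, hg⟩

/-! ### Kernel consequences of the certificate -/

/-- The certificate, unpacked: both basis checks hold at every `i < N5`. [cite: LooijengaLunts1997, §1 p. 4 (the sl₂-triple (e, h, f))] -/
theorem check5_spec {i : ℕ} (hi : i < N5) :
    basisSl2Check (colGen5 15) colLam5 hdeg5 i = true ∧ basisShiftCheck colLam5 hdeg5 (-2) i = true := by
  have h := certificate5
  rw [check5, Bool.and_eq_true, List.all_eq_true] at h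
  have := h.2 i (List.mem_range.mpr hi)
  simpa [Bool.and_eq_true] using this

/-- Seed `0` is non-zero. [cite: FuTianVial2019, Thm. 1.5 (and Thm. 1.4; the orbifold product of §2 with discrete torsion)] -/
theorem seedVec_zero_ne_zero : seedVec K 0 ≠ 0 := by
  have h := certificate5
  rw [check5, Bool.and_eq_true] at h
  have h0 := h.1
  unfold seed0Check5 at h0
  unfold seedVec
  split at h0
  · next i c heq =>
    rw [heq, toF_cons, toF_nil, add_zero]
    have hc : (c : K) ≠ 0 := by
      rw [Rat.cast_ne_zero]; simpa using h0
    exact Finsupp.single_ne_zero.mpr hc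
  · exact absurd h0 (by simp)

/-- Outside the layout all three operators vanish on basis vectors. [folklore] -/
private theorem colGen5_of_le {j i : ℕ} (hi : N5 ≤ i) : colGen5 j i = [] := by
  unfold colGen5; rw [if_pos hi]

/-- Outside the layout `Λ₀` vanishes. [folklore] -/
private theorem colLam5_of_le {i : ℕ} (hi : N5 ≤ i) : colLam5 i = [] := by
  unfold colLam5; rw [if_pos hi]

/-- Outside the layout `h` vanishes. [folklore] -/
private theorem hdeg5_of_le {i : ℕ} (hi : N5 ≤ i) : hdeg5 i = 0 := by
  unfold hdeg5; rw [if_pos hi]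

/-- `[L_{ω₀}, Λ₀] = h` on every basis vector. [cite: LooijengaLunts1997, §1 p. 4 (the sl₂-triple (e, h, f))] -/
theorem lef_lam_single (i : ℕ) (c : K) :
    lefOp K (lamOp K (Finsupp.single i c)) - lamOp K (lefOp K (Finsupp.single i c)) =
      degOp K (Finsupp.single i c) := by
  have hc : Finsupp.single i c = c • Finsupp.single i (1 : K) := by
    rw [Finsupp.smul_single, smul_eq_mul, mul_one]
  rw [hc, map_smul, map_smul, map_smul, map_smul, map_smul, ← smul_sub]
  congr 1
  unfold lefOp lamOp degOp
  rw [colOp_diagCol_single]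
  by_cases hi : i < N5
  · exact basisSl2Check_sound K (check5_spec hi).1
  · have hi' : N5 ≤ i := not_lt.mp hi
    rw [colOp_single, colOp_single, colLam5_of_le hi', colGen5_of_le hi', hdeg5_of_le hi', toF_nil,
      smul_zero, map_zero, map_zero, sub_zero, Rat.cast_zero, zero_smul]

/-- `[h, Λ₀] = -2Λ₀` on every basis vector. [cite: LooijengaLunts1997, §1 p. 4 (operators of degree ±2)] -/
theorem deg_lam_single (i : ℕ) (c : K) :
    degOp K (lamOp K (Finsupp.single i c)) - lamOp K (degOp K (Finsupp.single i c)) =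
      (-2 : K) • lamOp K (Finsupp.single i c) := by
  have hc : Finsupp.single i c = c • Finsupp.single i (1 : K) := by
    rw [Finsupp.smul_single, smul_eq_mul, mul_one]
  have key : degOp K (lamOp K (Finsupp.single i 1)) - lamOp K (degOp K (Finsupp.single i 1)) =
      (-2 : K) • lamOp K (Finsupp.single i 1) := by
    unfold lamOp degOp
    by_cases hi : i < N5
    · have := basisShiftCheck_sound K (check5_spec hi).2
      simpa using this
    · have hi' : N5 ≤ i := not_lt.mp hi
      rw [colOp_diagCol_single, map_smul, colOp_single, colLam5_of_le hi', toF_nil, smul_zero, smul_zero,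
        map_zero, sub_zero, smul_zero]
  rw [hc]
  simp only [map_smul]
  rw [← smul_sub, key, smul_comm]

/-- **`L_{ω₀} ∘ Λ₀ - Λ₀ ∘ L_{ω₀} = h`** as linear maps on the whole raw space. [cite: LooijengaLunts1997, §1 p. 4 (the sl₂-triple (e, h, f))] -/
theorem lef_comp_lam_sub : lefOp K ∘ₗ lamOp K - lamOp K ∘ₗ lefOp K = degOp K := by
  refine Finsupp.lhom_ext fun i c ↦ ?_
  simp only [LinearMap.sub_apply, LinearMap.comp_apply]
  exact lef_lam_single K i c

/-- **`h ∘ Λ₀ - Λ₀ ∘ h = -2 • Λ₀`** as linear maps on the whole raw space. [cite: LooijengaLunts1997, §1 p. 4 (operators of degree ±2)] -/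
theorem deg_comp_lam_sub : degOp K ∘ₗ lamOp K - lamOp K ∘ₗ degOp K = (-2 : K) • lamOp K := by
  refine Finsupp.lhom_ext fun i c ↦ ?_
  simp only [LinearMap.sub_apply, LinearMap.comp_apply, LinearMap.smul_apply]
  exact deg_lam_single K i c

/-- Pointwise forms. [cite: LooijengaLunts1997, §1 p. 4 (the sl₂-triple (e, h, f))] -/
theorem lef_lam_apply (v : ℕ →₀ K) :
    lefOp K (lamOp K v) - lamOp K (lefOp K v) = degOp K v := by
  have := congrArg (fun f ↦ f v) (lef_comp_lam_sub K)
  simpa using this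

/-- Pointwise form. [cite: LooijengaLunts1997, §1 p. 4 (operators of degree ±2)] -/
theorem deg_lam_apply (v : ℕ →₀ K) :
    degOp K (lamOp K v) - lamOp K (degOp K v) = (-2 : K) • lamOp K v := by
  have := congrArg (fun f ↦ f v) (deg_comp_lam_sub K)
  simpa using this

end Literature.Computation.KummerOrbifold
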